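import Mathlib
import HarnessLib
import Summits.HubbardSuperconductivity.HubbardSuperconductivity.Theorems.KLProgrammeSWaveCascadePinnedDomination

/-!
# Route `KLProgramme` — row 0′ (child 1): pinned domination under a CUMULATIVE pinned floor — the Cooper logarithm at zero transfer,
# `b_lo·n − s₀ ≤ Σ_{j<n} W_o(j)`, suffices for «sup over transfers, read at the pin» in `U`-currency (E1 docket (5′)(s2), conversion half, robust form of (D3))

Cell gate-hubbard-kl, seat hubbard-kl-k3c1-p1 (g20; child-1 lineage; technique «composed-map remainder propagation»).  Sequel to `…SWaveCascadePinnedDomination`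
(p705585/p706224: shortfall comparison `U'_n ≤ D·U_n`; §3 the PER-STEP pinned floor `b_lo ≤ W_o(n)` ⟹ `Σ a_n ≤ D²(b_M/b_lo)(257/225)U₀`).  The per-step floor is a
bookkeeping-dependent statement (how much pp weight ONE step carries at zero transfer); what the model supplies robustly is the CUMULATED pinned screening — the BCS /
Cooper logarithm `Σ_{j<n} W_o(j) ≳ N(0)·log(Λ_0/Λ_n)`, i.e. a floor growing LINEARLY in the scale index up to a constant.  THIS FILE shows that this weaker row suffices:

* `sWaveFloor_succ_sub_le_envelope`: shortfall-dominated transfer + free envelope `|W'_n| ≤ b_M` ⟹ `|U'_{n+1} − U'_n| ≤ D²·b_M·U_n·U_{n+1}` (read at the pin through the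
  VALUES);
* **`sWaveFloor_sum_mul_succ_le_of_cumulativeFloor`**: `0 < b_lo`, `U_0·s₀ < 1`, `b_lo·n − s₀ ≤ Σ_{j<n} W_j` (`n ≤ N`) ⟹ **`Σ_{n<N} U_n·U_{n+1} ≤ U_0/(b_lo·(1 − U_0·s₀))`**
  — by the closed form `U_n = U_0/(1 + U_0Σ_{j<n}W_j) ≤ U_0/y_n`, `y_n = 1 + U_0(b_lo·n − s₀)`, and the telescoping `U_0²/(y_n y_{n+1}) = (U_0/b_lo)(1/y_n − 1/y_{n+1})`;
* **`cascadeFamily_exists_pinnedAmplitude_of_cumulativeFloor`**: in a family of cascades (common start, law, floor, free envelope) with the cumulative pinned floor, the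
  amplitudes `a_n = D²·b_M·U_o(n)·U_o(n+1)` dominate `|U_q(n+1) − U_q(n)|` for every transfer frozen-or-shortfall-dominated at every step, and
  **`Σ_{n<N} a_n ≤ D²·b_M·U₀/(b_lo·(1 − U₀·s₀))`** — `U`-currency; the E1 rows for (s2) are then (D2) SHORTFALL + (D3′) CUMULATIVE PINNED FLOOR.

Everything is proved; no definitions; nothing about the model is asserted; nothing asserts (X).1, any open stub, K3 or superconductivity. [folklore]
-/

noncomputable section

namespace Summit.HubbardSuperconductivity.HubbardSuperconductivity.Theorems.SWaveCascade

set_option linter.dupNamespace false -- summit = problem name (single-conjunct summit), D-0017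

open Finset

/-! ## §1 One transfer against the pin: envelope-dominated decrement; the telescoping comparison -/

section CumulativeFloor

variable {U U' W W' ν ν' : ℕ → ℝ} {N : ℕ}

/-- **Envelope-dominated decrement.**  Two cascades from the same `U_0 ≥ 0` under the floor, `n < N`, shortfall `≤ Θ` before and after step `n`, `D ≥ 1` with
`D·(16U_0/15)·Θ ≤ D − 1`, and the free envelope `|W'_n| ≤ b_M`: `|U'_{n+1} − U'_n| ≤ D²·b_M·U_n·U_{n+1}` (read at the pin through the VALUES, not the masses). [folklore] -/
theorem sWaveFloor_succ_sub_le_envelope (h0 : 0 ≤ U 0) (h0' : U' 0 = U 0)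
    (hU : ∀ n, U (n + 1) = U n / (1 + W n * U n)) (hWν : ∀ n, -ν n ≤ W n) (hν0 : ∀ n, 0 ≤ ν n)
    (hsmall : 16 * U 0 * ∑ j ∈ range N, ν j ≤ 1)
    (hU' : ∀ n, U' (n + 1) = U' n / (1 + W' n * U' n)) (hWν' : ∀ n, -ν' n ≤ W' n) (hν0' : ∀ n, 0 ≤ ν' n)
    (hsmall' : 16 * U' 0 * ∑ j ∈ range N, ν' j ≤ 1) {n : ℕ} (hn : n < N) {Θ D bM : ℝ} (hΘ0 : 0 ≤ Θ) (hD : 1 ≤ D)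
    (hDΘ : D * (16 / 15 * U 0 * Θ) ≤ D - 1)
    (hΘn : ∑ j ∈ range n, (W j - W' j) ≤ Θ) (hΘn1 : ∑ j ∈ range (n + 1), (W j - W' j) ≤ Θ) (henv : |W' n| ≤ bM) :
    |U' (n + 1) - U' n| ≤ D ^ 2 * bM * (U n * U (n + 1)) := by
  have h0'' : 0 ≤ U' 0 := by rw [h0']; exact h0
  have hden' := (sWaveFloor_step h0'' hU' hWν' hν0' hsmall' n hn).1
  have hΔ' := sWaveFloor_succ_sub hU' hden'
  have hUn := (sWaveFloor_bounds h0 hU hWν hν0 hsmall n hn.le).1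
  have hU'n := (sWaveFloor_bounds h0'' hU' hWν' hν0' hsmall' n hn.le).1
  have hU'n1 := (sWaveFloor_bounds h0'' hU' hWν' hν0' hsmall' (n + 1) (Nat.succ_le_of_lt hn)).1
  have hc1 : U' n ≤ D * U n :=
    sWaveFloor_le_mul_of_shortfall h0 h0' hU hWν hν0 hsmall hU' hWν' hν0' hsmall' hn.le hΘ0 hD hDΘ hΘn
  have hc2 : U' (n + 1) ≤ D * U (n + 1) :=
    sWaveFloor_le_mul_of_shortfall h0 h0' hU hWν hν0 hsmall hU' hWν' hν0' hsmall' (Nat.succ_le_of_lt hn) hΘ0 hD hDΘ hΘn1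
  have hD0 : 0 ≤ D := by linarith
  have hbM : 0 ≤ bM := (abs_nonneg _).trans henv
  rw [hΔ', abs_neg]
  simp only [abs_mul, abs_of_nonneg hU'n, abs_of_nonneg hU'n1]
  have hP' : U' n * U' (n + 1) ≤ D ^ 2 * (U n * U (n + 1)) := by
    calc U' n * U' (n + 1) ≤ (D * U n) * (D * U (n + 1)) := mul_le_mul hc1 hc2 hU'n1 (mul_nonneg hD0 hUn)
      _ = D ^ 2 * (U n * U (n + 1)) := by ring
  calc |W' n| * U' n * U' (n + 1) = |W' n| * (U' n * U' (n + 1)) := by ring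
    _ ≤ bM * (D ^ 2 * (U n * U (n + 1))) := mul_le_mul henv hP' (mul_nonneg hU'n hU'n1) hbM
    _ = D ^ 2 * bM * (U n * U (n + 1)) := by ring

/-- **The telescoping comparison under a cumulative floor.**  One cascade from `U_0 ≥ 0` under the floor; if `0 < b_lo`, `U_0·s₀ < 1` and the cumulated masses obey
`b_lo·n − s₀ ≤ Σ_{j<n} W_j` for every `n ≤ N`, then `Σ_{n<N} U_n·U_{n+1} ≤ U_0/(b_lo·(1 − U_0·s₀))`. [folklore] -/
theorem sWaveFloor_sum_mul_succ_le_of_cumulativeFloor (h0 : 0 ≤ U 0) (hU : ∀ n, U (n + 1) = U n / (1 + W n * U n)) (hWν : ∀ n, -ν n ≤ W n)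
    (hν0 : ∀ n, 0 ≤ ν n) (hsmall : 16 * U 0 * ∑ j ∈ range N, ν j ≤ 1) {blo s₀ : ℝ} (hblo : 0 < blo) (hUs : U 0 * s₀ < 1)
    (hcum : ∀ n ≤ N, blo * n - s₀ ≤ ∑ j ∈ range n, W j) :
    ∑ n ∈ range N, U n * U (n + 1) ≤ U 0 / (blo * (1 - U 0 * s₀)) := by
  -- comparison denominators `y_n = 1 + U_0 (b_lo n − s₀) > 0`
  set y : ℕ → ℝ := fun n => 1 + U 0 * (blo * n - s₀) with hy
  have hy0 : ∀ n : ℕ, 0 < y n := fun n => by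
    have : 0 ≤ U 0 * (blo * n) := mul_nonneg h0 (mul_nonneg hblo.le (Nat.cast_nonneg n))
    simp only [hy]; nlinarith
  have hysucc : ∀ n : ℕ, y (n + 1) - y n = U 0 * blo := fun n => by simp only [hy]; push_cast; ring
  -- `U_n ≤ U_0 / y_n`
  have hUle : ∀ n ≤ N, U n ≤ U 0 / y n := by
    intro n hn
    obtain ⟨hd, he⟩ := sWaveFloor_eq_div h0 hU hWν hν0 hsmall n hn
    rw [he]
    exact div_le_div_of_nonneg_left h0 (hy0 n) (by have := mul_le_mul_of_nonneg_left (hcum n hn) h0; simp only [hy]; linarith)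
  have hUnn : ∀ n ≤ N, 0 ≤ U n := fun n hn => (sWaveFloor_bounds h0 hU hWν hν0 hsmall n hn).1
  -- termwise comparison and telescoping
  have hterm : ∀ n < N, U n * U (n + 1) ≤ U 0 / blo * (1 / y n - 1 / y (n + 1)) := by
    intro n hn
    have h1 := hUle n hn.le
    have h2 := hUle (n + 1) (Nat.succ_le_of_lt hn)
    have hprod : U n * U (n + 1) ≤ (U 0 / y n) * (U 0 / y (n + 1)) :=
      mul_le_mul h1 h2 (hUnn (n + 1) (Nat.succ_le_of_lt hn)) (div_nonneg h0 (hy0 n).le)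
    refine hprod.trans (le_of_eq ?_)
    have hyn := (hy0 n).ne'
    have hyn1 := (hy0 (n + 1)).ne'
    rw [div_sub_div _ _ hyn hyn1, one_mul, mul_one, show y (n + 1) - y n = U 0 * blo from hysucc n]
    field_simp
  calc ∑ n ∈ range N, U n * U (n + 1) ≤ ∑ n ∈ range N, U 0 / blo * (1 / y n - 1 / y (n + 1)) :=
        sum_le_sum fun n hn => hterm n (mem_range.1 hn)
    _ = U 0 / blo * (1 / y 0 - 1 / y N) := by
        rw [← mul_sum, Finset.sum_range_sub' (fun n => 1 / y n) N]
    _ ≤ U 0 / blo * (1 / y 0) := by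
        refine mul_le_mul_of_nonneg_left ?_ (div_nonneg h0 hblo.le)
        have : 0 < 1 / y N := one_div_pos.2 (hy0 N)
        linarith
    _ = U 0 / (blo * (1 - U 0 * s₀)) := by
        have : y 0 = 1 - U 0 * s₀ := by simp only [hy]; push_cast; ring
        rw [this, div_mul_div_comm, mul_one]

end CumulativeFloor

/-! ## §2 The family form -/

section CumulativeFloorFamily

variable {ι : Type*} {Uq Wq νq : ι → ℕ → ℝ} {U₀ : ℝ} {N : ℕ}

/-- **Amplitudes read at the pin from the envelope, the shortfall and the CUMULATIVE pinned floor** (the Cooper logarithm at zero transfer,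
`b_lo·n − s₀ ≤ Σ_{j<n} W_o(j)` for `n ≤ N`, `0 < b_lo`, `U₀·s₀ < 1`): a family of cascades as in §2 with the free envelope `|W_q(n)| ≤ b_M` has amplitudes
`a_n = D²·b_M·U_o(n)·U_o(n+1)` with `|U_q(n+1) − U_q(n)| ≤ a_n` (`n < N`) for every transfer frozen-or-shortfall-dominated at every step, and
`Σ_{n<N} a_n ≤ D²·b_M·U₀/(b_lo·(1 − U₀·s₀))` — (s2) from (D2) + the cumulative (D3). [folklore] -/
theorem cascadeFamily_exists_pinnedAmplitude_of_cumulativeFloor (o : ι) (hU₀ : 0 ≤ U₀) (h0 : ∀ q, Uq q 0 = U₀)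
    (hU : ∀ q n, Uq q (n + 1) = Uq q n / (1 + Wq q n * Uq q n)) (hWν : ∀ q n, -νq q n ≤ Wq q n) (hν0 : ∀ q n, 0 ≤ νq q n)
    (hsmall : ∀ q, 16 * U₀ * ∑ j ∈ range N, νq q j ≤ 1) {Θ D bM blo s₀ : ℝ} (hΘ0 : 0 ≤ Θ) (hD : 1 ≤ D)
    (hDΘ : D * (16 / 15 * U₀ * Θ) ≤ D - 1) (henv : ∀ q n, |Wq q n| ≤ bM) (hblo : 0 < blo) (hUs : U₀ * s₀ < 1)
    (hcum : ∀ n ≤ N, blo * n - s₀ ≤ ∑ j ∈ range n, Wq o j) :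
    ∃ a : ℕ → ℝ, (∀ n, 0 ≤ a n) ∧
      (∀ q, (∀ n < N, Wq q n = 0 ∨
          (∑ j ∈ range n, (Wq o j - Wq q j) ≤ Θ ∧ ∑ j ∈ range (n + 1), (Wq o j - Wq q j) ≤ Θ)) →
        ∀ n < N, |Uq q (n + 1) - Uq q n| ≤ a n) ∧
      ∑ n ∈ range N, a n ≤ D ^ 2 * bM * (U₀ / (blo * (1 - U₀ * s₀))) := by
  have ho0 : 0 ≤ Uq o 0 := by rw [h0 o]; exact hU₀
  have hsmo : 16 * Uq o 0 * ∑ j ∈ range N, νq o j ≤ 1 := by rw [h0 o]; exact hsmall o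
  have hDΘ' : D * (16 / 15 * Uq o 0 * Θ) ≤ D - 1 := by rw [h0 o]; exact hDΘ
  have hbM : 0 ≤ bM := (abs_nonneg _).trans (henv o 0)
  have hUs' : Uq o 0 * s₀ < 1 := by rw [h0 o]; exact hUs
  -- nonnegativity of the pinned values at all indices (past `N` included): the amplitudes must be nonnegative everywhere
  refine ⟨fun n => if n < N then D ^ 2 * bM * (Uq o n * Uq o (n + 1)) else 0, fun n => ?_, fun q hq n hn => ?_, ?_⟩
  · dsimp only
    by_cases hn : n < N
    · rw [if_pos hn]
      have h1 := (sWaveFloor_bounds ho0 (hU o) (hWν o) (hν0 o) hsmo n hn.le).1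
      have h2 := (sWaveFloor_bounds ho0 (hU o) (hWν o) (hν0 o) hsmo (n + 1) (Nat.succ_le_of_lt hn)).1
      exact mul_nonneg (mul_nonneg (sq_nonneg _) hbM) (mul_nonneg h1 h2)
    · rw [if_neg hn]
  · dsimp only
    rw [if_pos hn]
    have hqo : Uq q 0 = Uq o 0 := by rw [h0 q, h0 o]
    have hsmq : 16 * Uq q 0 * ∑ j ∈ range N, νq q j ≤ 1 := by rw [h0 q]; exact hsmall q
    rcases hq n hn with hz | ⟨hΘn, hΘn1⟩
    · rw [sWaveCascade_succ_eq_of_mass_zero (hU q) hz, sub_self, abs_zero]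
      have h1 := (sWaveFloor_bounds ho0 (hU o) (hWν o) (hν0 o) hsmo n hn.le).1
      have h2 := (sWaveFloor_bounds ho0 (hU o) (hWν o) (hν0 o) hsmo (n + 1) (Nat.succ_le_of_lt hn)).1
      exact mul_nonneg (mul_nonneg (sq_nonneg _) hbM) (mul_nonneg h1 h2)
    · exact sWaveFloor_succ_sub_le_envelope ho0 hqo (hU o) (hWν o) (hν0 o) hsmo (hU q) (hWν q) (hν0 q) hsmq hn hΘ0 hD hDΘ'
        hΘn hΘn1 (henv q n)
  · have hsum := sWaveFloor_sum_mul_succ_le_of_cumulativeFloor ho0 (hU o) (hWν o) (hν0 o) hsmo hblo hUs' hcum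
    rw [h0 o] at hsum
    calc ∑ n ∈ range N, (if n < N then D ^ 2 * bM * (Uq o n * Uq o (n + 1)) else 0)
        = ∑ n ∈ range N, D ^ 2 * bM * (Uq o n * Uq o (n + 1)) := sum_congr rfl fun n hn => if_pos (mem_range.1 hn)
      _ = D ^ 2 * bM * ∑ n ∈ range N, Uq o n * Uq o (n + 1) := by rw [mul_sum]
      _ ≤ D ^ 2 * bM * (U₀ / (blo * (1 - U₀ * s₀))) := mul_le_mul_of_nonneg_left hsum (mul_nonneg (sq_nonneg _) hbM)

end CumulativeFloorFamily

end Summit.HubbardSuperconductivity.HubbardSuperconductivity.Theorems.SWaveCascade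

end
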